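import Summits.QuantumFields.YangMills.Theorems.LuscherReductionOneSiteLevelsValleySeam
import Summits.QuantumFields.YangMills.Theorems.FemtoTransferGapZeroModes

/-!
# VALLEY, step 0: the concrete valley stub follows from ONE `k`-uniform gain on the valley region
# (support module for `stub_absUpperValleyMag` of crux `OneSiteLevels`, route `LuscherReduction`, item stmt-QuantumFields-20007;
# fleet lead prover ym-luscher-20007-p1 g2)

The registered stub `stub_absUpperValleyMag : ∀ k, OneSiteAbsUpperValleyMag k` asks, for every level `k`, that the valley piece
`f = cos Φ_B · sin Θ_B · ψ` (`Φ_B = magPhase √λ_b`, `Θ_B = onePhase √λ_b`) of every physical `ψ` obey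
`⟨f, K_B f⟩ ≤ linkCE B · e^{−E_kλ_b + C₁λ_b²} ‖f‖²` for `B ≥ B₁(k)`.  The `sin Θ_B` factor kills `f` wherever every link is within `√λ_b` of
`±1`; in the zero-mode coordinates `x = zmCoord 1 U` (the three colour vectors `u⃗_e`, `|u⃗_e|² = 1 − u_{e,0}²`) this contains the ball
`‖x‖² < λ_b/4` (`vacDist(U_e)² = 4(1 − |u_{e,0}|) ≤ 4|u⃗_e|²`, `vacDist_sq_le_four_mul_sum_vecPart_sq`).  Hence (`absUpperValleyMag_of_gain`)
the stub for ALL `k` at once, with `C₁ = 0`, follows from a single `k`-independent statement: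

  (GAIN)  for `B ≥ B₀` and every bounded measurable `f` vanishing on `{‖zmCoord 1 U‖² < λ_b/4}`:
          `⟨f, K_B f⟩ ≤ linkCE B · (1 − c₀ B^{−a}) · ‖f‖²`   with `c₀ > 0`, `a < 1/3`,

because `λ_b = (2/B)^{1/3}` so `E_k λ_b ≤ c₀ B^{−a}` eventually (`mul_bareLambda_le_gain`) and `1 − x ≤ e^{−x}`.  (GAIN) — transverse
zero-point confinement at rate `≍ √λ_b ≫ λ_b` on the valley region — is the analytic content of the remaining VALLEY modules.

## WHAT THIS IS NOT
(GAIN) is not proved here; NOT the crux, NOT THE CLAY GAP.  Sorry-free; no new definition, no named fact.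
-/

set_option autoImplicit false

noncomputable section

open MeasureTheory Filter Topology Real
open scoped Matrix ComplexConjugate BigOperators
open Literature.MathematicalPhysics.QuantumFieldTheory
open Literature.MathematicalPhysics.QuantumLattice
open Literature.Analysis.OperatorTheory.YMMatrixModel

namespace Summit.QuantumFields.YangMills.Theorems.FemtoTransferGap

/-! ### §1. The valley radius `‖zmCoord 1 U‖` and the support of the `sin Θ`-piece -/

/-- `vacDist(W)² = 4(1 − |w₀|) ≤ 4(1 − w₀²) = 4|w⃗|²`: the distance of a link to the centre `{±1}` is controlled by its vector part.
[folklore] -/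
theorem vacDist_sq_le_four_mul_sum_vecPart_sq (W : SU2) : vacDist W ^ 2 ≤ 4 * ∑ a, vecPart W a ^ 2 := by
  rw [sum_vecPart_sq]
  have h := abs_scalarPart_le W
  rw [abs_le] at h
  have h0 := vacDist_nonneg W
  by_cases hs : 0 ≤ scalarPart W
  · have h2 : vacDist W ^ 2 ≤ frobNorm ((W : Matrix (Fin 2) (Fin 2) ℂ) - 1) ^ 2 :=
      pow_le_pow_left₀ h0 (vacDist_le_sub_one W) 2
    rw [frobNorm_sub_one_sq_eq_scalarPart] at h2
    nlinarith [h.2]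
  · push Not at hs
    have h2 : vacDist W ^ 2 ≤ frobNorm ((W : Matrix (Fin 2) (Fin 2) ℂ) + 1) ^ 2 :=
      pow_le_pow_left₀ h0 (vacDist_le_add_one W) 2
    rw [frobNorm_add_one_sq_eq_scalarPart] at h2
    nlinarith [h.1]

/-- The squared valley radius is the sum of the squared vector parts of the three links:
`‖zmCoord 1 U‖² = Σ_i Σ_a vecPart(U_i)_a²`. [folklore] -/
theorem norm_zmCoord_one_sq (U : Cfg) : ‖zmCoord 1 U‖ ^ 2 = ∑ i : Fin 3, ∑ a : Fin 3, vecPart (U (edgeOf i)) a ^ 2 := by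
  rw [EuclideanSpace.norm_sq_eq, Fintype.sum_prod_type]
  refine Finset.sum_congr rfl fun i _ => Finset.sum_congr rfl fun a _ => ?_
  rw [Real.norm_eq_abs, sq_abs, zmCoord_apply, div_one]

/-- Each link's squared vector part is at most the squared valley radius. [folklore] -/
theorem sum_vecPart_sq_le_norm_zmCoord_sq (U : Cfg) (e : Edge 3 1) :
    ∑ a : Fin 3, vecPart (U e) a ^ 2 ≤ ‖zmCoord 1 U‖ ^ 2 := by
  rw [norm_zmCoord_one_sq]
  have h := Finset.single_le_sum (f := fun i : Fin 3 => ∑ a : Fin 3, vecPart (U (edgeOf i)) a ^ 2)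
    (fun i _ => Finset.sum_nonneg fun a _ => sq_nonneg _) (Finset.mem_univ e.2)
  rwa [edgeOf_snd] at h

/-- Inside the ball `‖zmCoord 1 U‖² < ℓ²/4` every link is within `ℓ` of the centre, so the IMS phase `Θ_ℓ` vanishes and with it the
`sin Θ_ℓ`-piece. [cite: SimonB1983DiscreteSpectrum, §3] -/
theorem sin_onePhase_eq_zero_of_norm_zmCoord_sq_lt {ℓ : ℝ} (hℓ : 0 < ℓ) {U : Cfg}
    (hU : ‖zmCoord 1 U‖ ^ 2 < ℓ ^ 2 / 4) : Real.sin (onePhase ℓ U) = 0 := by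
  have hall : ∀ e : Edge 3 1, vacDist (U e) ≤ ℓ := by
    intro e
    have hle := sum_vecPart_sq_le_norm_zmCoord_sq U e
    have h4 := vacDist_sq_le_four_mul_sum_vecPart_sq (U e)
    have hsq : vacDist (U e) ^ 2 < ℓ ^ 2 := by linarith
    exact (lt_of_pow_lt_pow_left₀ 2 hℓ.le hsq).le
  rw [onePhase_eq_zero hℓ hall, Real.sin_zero]

/-- At the crux's IMS scale `ℓ = √λ_b`: the valley piece `cos Φ_B · sin Θ_B · ψ` vanishes on the ball `‖zmCoord 1 U‖² < λ_b/4`.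
[cite: SimonB1983DiscreteSpectrum, §3] -/
theorem valleyPiece_eq_zero_of_norm_zmCoord_sq_lt {B : ℝ} (hB : 0 < B) (ψ : Cfg → ℝ) {U : Cfg}
    (hU : ‖zmCoord 1 U‖ ^ 2 < bareLambda B / 4) :
    Real.cos (magPhase (onePhaseScale B) U) * (Real.sin (onePhase (onePhaseScale B) U) * ψ U) = 0 := by
  have h : ‖zmCoord 1 U‖ ^ 2 < onePhaseScale B ^ 2 / 4 := by rwa [onePhaseScale_sq hB]
  rw [sin_onePhase_eq_zero_of_norm_zmCoord_sq_lt (onePhaseScale_pos hB) h, zero_mul, mul_zero]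

/-! ### §2. `E λ_b ≤ c₀ B^{−a}` eventually, for `a < 1/3` -/

/-- `λ_b(B) = 2^{1/3} · B^{−1/3}` for `B > 0`. [cite: Luscher1983, §1] -/
theorem bareLambda_eq_rpow {B : ℝ} (hB : 0 < B) : bareLambda B = (2 : ℝ) ^ ((1 : ℝ) / 3) * B ^ (-(1 : ℝ) / 3) := by
  unfold bareLambda
  rw [Real.div_rpow (by norm_num) hB.le, div_eq_mul_inv, ← Real.rpow_neg hB.le]
  norm_num

/-- For `c₀ > 0` and `a < 1/3` the gain `c₀ B^{−a}` eventually dominates `E λ_b = E (2/B)^{1/3}` (any fixed `E`). [folklore] -/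
theorem mul_bareLambda_le_gain {c₀ a : ℝ} (hc₀ : 0 < c₀) (ha : a < 1 / 3) (E : ℝ) :
    ∃ T : ℝ, 1 ≤ T ∧ ∀ B, T ≤ B → E * bareLambda B ≤ c₀ * B ^ (-a) := by
  by_cases hE : E ≤ 0
  · refine ⟨1, le_rfl, fun B hB => ?_⟩
    have hBpos : 0 < B := by linarith
    have h1 : 0 ≤ bareLambda B := by unfold bareLambda; positivity
    have h2 : 0 < c₀ * B ^ (-a) := mul_pos hc₀ (Real.rpow_pos_of_pos hBpos _)
    nlinarith
  push Not at hE
  set p : ℝ := 1 / 3 - a with hp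
  have hp0 : 0 < p := by rw [hp]; linarith
  set M : ℝ := E * (2 : ℝ) ^ ((1 : ℝ) / 3) / c₀ with hM
  have hM0 : 0 ≤ M := by rw [hM]; positivity
  refine ⟨max 1 (M ^ (1 / p)), le_max_left _ _, fun B hB => ?_⟩
  have hB1 : 1 ≤ B := le_trans (le_max_left _ _) hB
  have hBpos : 0 < B := by linarith
  have hBM : M ^ (1 / p) ≤ B := le_trans (le_max_right _ _) hB
  -- `M ≤ B ^ p`
  have hMp : M ≤ B ^ p := by
    have h1 : (M ^ (1 / p)) ^ p ≤ B ^ p := Real.rpow_le_rpow (by positivity) hBM hp0.le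
    rwa [← Real.rpow_mul hM0, one_div_mul_cancel hp0.ne', Real.rpow_one] at h1
  rw [bareLambda_eq_rpow hBpos]
  -- `E 2^{1/3} B^{-1/3} ≤ c₀ B^{-a}` ⟸ `E 2^{1/3} ≤ c₀ B^{p}` since `B^{-a} = B^{-1/3} · B^{p}`
  have hsplit : B ^ (-a) = B ^ (-(1 : ℝ) / 3) * B ^ p := by
    rw [← Real.rpow_add hBpos]; congr 1; rw [hp]; ring
  have hE2 : E * (2 : ℝ) ^ ((1 : ℝ) / 3) ≤ c₀ * B ^ p := by
    have := (div_le_iff₀ hc₀).1 (hM ▸ hMp : E * (2 : ℝ) ^ ((1 : ℝ) / 3) / c₀ ≤ B ^ p)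
    linarith [this]
  have hB3 : 0 < B ^ (-(1 : ℝ) / 3) := Real.rpow_pos_of_pos hBpos _
  calc E * ((2 : ℝ) ^ ((1 : ℝ) / 3) * B ^ (-(1 : ℝ) / 3))
      = (E * (2 : ℝ) ^ ((1 : ℝ) / 3)) * B ^ (-(1 : ℝ) / 3) := by ring
    _ ≤ (c₀ * B ^ p) * B ^ (-(1 : ℝ) / 3) := mul_le_mul_of_nonneg_right hE2 hB3.le
    _ = c₀ * B ^ (-a) := by rw [hsplit]; ring

/-! ### §3. The reduction: (GAIN) ⟹ `OneSiteAbsUpperValleyMag k` for every `k` (with `C₁ = 0`) -/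

/-- **VALLEY from ONE `k`-uniform gain.**  If for `B ≥ B₀` every bounded measurable `f` vanishing on the ball `‖zmCoord 1 U‖² < λ_b/4`
satisfies `⟨f, K_B f⟩ ≤ linkCE B · (1 − c₀ B^{−a}) ‖f‖²` with `c₀ > 0` and `a < 1/3`, then for every `k` the valley piece
`cos Φ_B · sin Θ_B · ψ` of every physical `ψ` obeys the crux rate `linkCE B · e^{−E_kλ_b}` (`E_k = physLevel (k+1)`, slack `C₁ = 0`) for
`B ≥ B₁(k)` — i.e. `OneSiteAbsUpperValleyMag k` of the skeleton, verbatim. [cite: SimonB1983DiscreteSpectrum, §2–§3] [cite: Luscher1983, §2] -/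
theorem absUpperValleyMag_of_gain {c₀ a B₀ : ℝ} (hc₀ : 0 < c₀) (ha : a < 1 / 3)
    (hgain : ∀ B : ℝ, B₀ ≤ B → ∀ f : Cfg → ℝ, Measurable f → (∃ C : ℝ, ∀ U, |f U| ≤ C) →
      (∀ U, ‖zmCoord 1 U‖ ^ 2 < bareLambda B / 4 → f U = 0) →
      qform su2Rep B f f ≤ linkCE B * (1 - c₀ * B ^ (-a)) * l2 f f)
    (k : ℕ) :
    ∃ C₁ B₁ : ℝ, 2 ≤ B₁ ∧ ∀ B, B₁ ≤ B → ∀ ψ : Cfg → ℝ, IsPhys ψ →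
      qform su2Rep B (fun U => Real.cos (magPhase (onePhaseScale B) U) * (Real.sin (onePhase (onePhaseScale B) U) * ψ U))
          (fun U => Real.cos (magPhase (onePhaseScale B) U) * (Real.sin (onePhase (onePhaseScale B) U) * ψ U))
        ≤ linkCE B * Real.exp (-(physLevel (k + 1) * bareLambda B) + C₁ * bareLambda B ^ 2)
          * l2 (fun U => Real.cos (magPhase (onePhaseScale B) U) * (Real.sin (onePhase (onePhaseScale B) U) * ψ U))
               (fun U => Real.cos (magPhase (onePhaseScale B) U) * (Real.sin (onePhase (onePhaseScale B) U) * ψ U)) := by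
  obtain ⟨T, hT1, hT⟩ := mul_bareLambda_le_gain hc₀ ha (physLevel (k + 1))
  refine ⟨0, max (max 2 B₀) T, le_trans (le_max_left _ _) (le_max_left _ _), fun B hB ψ hψ => ?_⟩
  have hB2 : 2 ≤ B := le_trans (le_trans (le_max_left _ _) (le_max_left _ _)) hB
  have hB0 : B₀ ≤ B := le_trans (le_trans (le_max_right _ _) (le_max_left _ _)) hB
  have hBT : T ≤ B := le_trans (le_max_right _ _) hB
  have hBpos : 0 < B := by linarith
  set f : Cfg → ℝ := fun U => Real.cos (magPhase (onePhaseScale B) U) * (Real.sin (onePhase (onePhaseScale B) U) * ψ U) with hf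
  -- the valley piece is bounded, measurable and vanishes on the ball
  have hfm : Measurable f :=
    (Real.continuous_cos.measurable.comp (measurable_magPhase _)).mul
      ((Real.continuous_sin.measurable.comp (measurable_onePhase _)).mul hψ.measurable)
  have hfb : ∃ C : ℝ, ∀ U, |f U| ≤ C := by
    obtain ⟨C, hC⟩ := hψ.bounded
    refine ⟨C, fun U => ?_⟩
    rw [hf]
    dsimp only
    rw [abs_mul, abs_mul]
    have h1 := Real.abs_cos_le_one (magPhase (onePhaseScale B) U)
    have h2 := Real.abs_sin_le_one (onePhase (onePhaseScale B) U)
    have h3 := hC U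
    have h0 : 0 ≤ |ψ U| := abs_nonneg _
    calc |Real.cos (magPhase (onePhaseScale B) U)| * (|Real.sin (onePhase (onePhaseScale B) U)| * |ψ U|)
        ≤ 1 * (1 * |ψ U|) := by gcongr
      _ ≤ C := by simpa using h3
  have hf0 : ∀ U, ‖zmCoord 1 U‖ ^ 2 < bareLambda B / 4 → f U = 0 :=
    fun U hU => valleyPiece_eq_zero_of_norm_zmCoord_sq_lt hBpos ψ hU
  have hq := hgain B hB0 f hfm hfb hf0
  -- `1 − c₀ B^{−a} ≤ e^{−E λ_b}`
  have hkey : 1 - c₀ * B ^ (-a) ≤ Real.exp (-(physLevel (k + 1) * bareLambda B) + 0 * bareLambda B ^ 2) := by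
    rw [zero_mul, add_zero]
    have h1 := hT B hBT
    have h2 := Real.add_one_le_exp (-(physLevel (k + 1) * bareLambda B))
    linarith
  have hl2 : 0 ≤ l2 f f := integral_nonneg fun U => mul_self_nonneg _
  have hCE : 0 ≤ linkCE B := (linkCE_pos hBpos.le).le
  calc qform su2Rep B f f ≤ linkCE B * (1 - c₀ * B ^ (-a)) * l2 f f := hq
    _ ≤ linkCE B * Real.exp (-(physLevel (k + 1) * bareLambda B) + 0 * bareLambda B ^ 2) * l2 f f :=
        mul_le_mul_of_nonneg_right (mul_le_mul_of_nonneg_left hkey hCE) hl2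

end Summit.QuantumFields.YangMills.Theorems.FemtoTransferGap

end
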